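import Summits.ABC.IUTFork.Joshi.TestATS4LowerBoundGenuineRealising
import Mathlib.NumberTheory.NumberField.Cyclotomic.Ideal
import Mathlib.NumberTheory.NumberField.Cyclotomic.Basic
import HarnessLib

/-!
# R-J census, row Y-21ℓ — the REALISING countermodel is INHABITED over `ℚ(ζ₅)`: `j_E := 3^{−10}`, `S := V(F)₃`, `l := 5`

Proof-only record file of the abc-iut cell, branch E → R-J «Joshi Y-discharge census» (D-0079; rung LADDER-ABC:A2.RESCUE.J; seat
abc-iut-E-t59, gen 9; part IV, the NON-VACUITY of part III `TestATS4LowerBoundGenuineRealising.statement_and_not_cor91111_of_realising`: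
«pilot data over `F` whose bad places fill the fibres over a set `U` of odd unramified primes with `ord_v(q_v) = 2l·e_v·m_q(p)`, one prime
`p₀` with a SINGLE place of ramification index `e ≥ 2`, and `((ℓ⋆+1)(2ℓ⋆+1)/6 − 1)·Σ_{p∈U} m_q(p)·log p ≤ ((e−1)/e)·((ℓ⋆+1)/2)·log p₀` ⟹ at
ALL realising ideles OUR typed Cor. 3.12 Statement holds and Joshi's Cor 9.11.1.1 read through the dictionary fails»). **No side is
taken** on [IUTchIII] Cor. 3.12 / [IUTchIV] Thm 1.10, on [J-III] Cor 9.11.1.1 (unrefereed arXiv preprint) or on any author; typed ≠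
proved ≠ endorsed; instantiated ≠ endorsed; no definition, no `Prop` fact.

**`exists_pilotData_cyclotomicField_five_realising_hypotheses`** — over `F = ℚ(ζ₅)` (Mathlib's `CyclotomicField 5 ℚ`; `[F:ℚ] = 4`,
`disc F = 5³ = 125`, Mathlib `IsCyclotomicExtension.Rat.discr_prime`; the prime `5` is TOTALLY ramified: ONE place `v₀ = (ζ₅ − 1)` with
`e = 4`, Mathlib `IsCyclotomicExtension.Rat.ramificationIdx_eq_of_prime` / `eq_span_zeta_sub_one_of_liesOver'`; `√−1 ∉ F`, so — like the
cell's ℚ-beds — a bed, not the field of moduli of an initial Θ-datum) the pilot datum `j_E := 3^{−10}`, `S := V(F)₃` (`3` is ODD and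
UNRAMIFIED, `3 ∤ 125`; every place over `3` is bad: bad mass one; `ord_v(q_v) = −ord_v(j_E) = 10·e_v = 2·l·e_v·1`), `l := 5` (`ℓ⋆ = 2`),
with `U = {3}`, `m_q(3) = 1`, `p₀ = 5` meets EVERY hypothesis of part III, the window inequality being
`(3·5/6 − 1)·log 3 = (3/2)·log 3 ≤ (3/4)·(3/2)·log 5 = (9/8)·log 5`, i.e. `3¹² = 531441 ≤ 5⁹ = 1953125`.
Hence (part III §2–§3): at this genuine tame datum, for every Thm-3.11 context, realising pilot ideles EXIST and for ALL of them OUR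
typed [IUTchIII] Cor. 3.12 Statement HOLDS while [J-III] Cor 9.11.1.1 read through the dictionary FAILS for every reading datum — the
converse of Y-21ℓ is REFUTED ON PRINT'S OWN NORMALISATION (gap `(3/2)·log 3 ≈ 1.648` inside the inflation window, whose length is
`≥ (9/8)·log 5 ≈ 1.810` by the quantitative ramified hull gain at the `5`-packets). HONEST SCOPE as in parts I–III ((Ind2) as typed at
the real setting; sharp (Ind3) reading; trivial archimedean container; the Statement holds BY (Ind1)/(Ind2)-INFLATION of the unit boxes
at the ramified packet, «saying nothing about print's intended content»); vs S: S-BYPASSED (p447958). A PilotData-level inhabitant only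
(no elliptic curve, no `K = F(E[l])`). [claim: Joshi2024ATS3, status: disputed] [claim: Mochizuki2012, status: disputed]
[cite: DupuyHilado2025, §3.3] [cite: NeukirchANT1999, Ch. I (10.1), Ch. II Prop. (6.8)]. Standard axioms.
-/

noncomputable section

open Set Function NumberField IsDedekindDomain Finset
open scoped Pointwise

namespace Summit.ABC.IUTFork.Joshi

open Thm311 Thm311.Real Cor312 Cor312.Setting Cor312Vol Literature.IUT.LogThetaLattice Literature.IUT.LogVolume
  Literature.IUT.HodgeTheaters Literature.NumberTheory.NumberFields

namespace TestATS4LowerBound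

/-- The arithmetic of the window at `ℚ(ζ₅)`: `(3/2)·log 3 ≤ (9/8)·log 5` (`3¹² ≤ 5⁹`). [folklore] -/
theorem three_halves_log_three_le : (3 / 2 : ℝ) * Real.log 3 ≤ (9 / 8 : ℝ) * Real.log 5 := by
  have h : Real.log ((3 : ℝ) ^ 12) ≤ Real.log ((5 : ℝ) ^ 9) :=
    Real.log_le_log (by positivity) (by norm_num)
  rw [Real.log_pow, Real.log_pow] at h
  push_cast at h
  linarith

/-- **NON-VACUITY of part III over `ℚ(ζ₅)`.** The pilot datum `j_E := 3^{−10}`, `S := V(F)₃`, `l := 5` over `F = CyclotomicField 5 ℚ`,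
with `U = {3}`, `m_q(3) = 1`, `p₀ = 5` and `v₀` the place over `5`, satisfies every hypothesis of
`statement_and_not_cor91111_of_realising` / `exists_realising_ideles`: bad mass one over `U`; `3` odd and unramified (`disc F = 125`);
`ord_v(q_v) = 2·l·e_v·m_q` over `3`; `5` has ONE place, of ramification index `4 ≥ 2`; and the window inequality.
[cite: DupuyHilado2025, §3.3] [cite: NeukirchANT1999, Ch. I (10.1)] [claim: Mochizuki2012, status: disputed] (the pilot-object shape) -/
theorem exists_pilotData_cyclotomicField_five_realising_hypotheses :
    ∃ (X : PilotData (CyclotomicField 5 ℚ)) (U : Finset Nat.Primes) (mq : Nat.Primes → ℕ) (p₀ : Nat.Primes)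
      (v₀ : HeightOneSpectrum (𝓞 (CyclotomicField 5 ℚ))) (_ : (thetaIndex X).over (.inr v₀) = .inr p₀)
      (hvp₀ : ((p₀ : ℕ) : 𝓞 (CyclotomicField 5 ℚ)) ∈ v₀.asIdeal),
      (∀ (pp : Nat.Primes) (x : (thetaIndex X).Fibre (.inr pp)),
        haveI : Fact (pp : ℕ).Prime := ⟨pp.2⟩; placeOf X pp.1 x ∈ X.S → pp ∈ U) ∧
      (∀ (pp : Nat.Primes), pp ∈ U → ∀ (x : (thetaIndex X).Fibre (.inr pp)),
        haveI : Fact (pp : ℕ).Prime := ⟨pp.2⟩; placeOf X pp.1 x ∈ X.S) ∧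
      (∀ pp ∈ U, 2 < (pp : ℕ)) ∧ (∀ pp ∈ U, ¬ ((pp : ℕ) : ℤ) ∣ NumberField.discr (CyclotomicField 5 ℚ)) ∧
      (∀ (pp : Nat.Primes), pp ∈ U → ∀ (x : (thetaIndex X).Fibre (.inr pp)),
        haveI : Fact (pp : ℕ).Prime := ⟨pp.2⟩;
        (X.ordq (placeOf X pp.1 x) : ℝ) = 2 * X.l * ramIdx (CyclotomicField 5 ℚ) (placeOf X pp.1 x) * mq pp) ∧
      (haveI : Fact (p₀ : ℕ).Prime := ⟨p₀.2⟩;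
        2 ≤ absRamificationIdx (p₀ : ℕ) (RescaledCompletion (CyclotomicField 5 ℚ) (p₀ : ℕ) v₀ hvp₀)) ∧
      (∀ w ∈ placesOver (CyclotomicField 5 ℚ) (p₀ : ℕ), w = v₀) ∧
      (haveI : Fact (p₀ : ℕ).Prime := ⟨p₀.2⟩;
        ((((thetaIndex X).lstar : ℝ) + 1) * (2 * (thetaIndex X).lstar + 1) / 6 - 1) *
            ∑ pp ∈ U, (mq pp : ℝ) * Real.log (pp : ℕ) ≤
          (((absRamificationIdx (p₀ : ℕ) (RescaledCompletion (CyclotomicField 5 ℚ) (p₀ : ℕ) v₀ hvp₀) : ℝ) - 1) /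
              (absRamificationIdx (p₀ : ℕ) (RescaledCompletion (CyclotomicField 5 ℚ) (p₀ : ℕ) v₀ hvp₀) : ℝ)) *
            ((((thetaIndex X).lstar : ℝ) + 1) / 2) * Real.log (p₀ : ℕ)) := by
  classical
  set K := CyclotomicField 5 ℚ with hK
  haveI hcyc : IsCyclotomicExtension {5} ℚ K := CyclotomicField.isCyclotomicExtension 5 ℚ
  haveI h3 : Fact (Nat.Prime 3) := ⟨Nat.prime_three⟩
  haveI h5 : Fact (Nat.Prime 5) := ⟨by norm_num⟩
  -- `ord_v(j_E) = −10·e_v < 0` at every place over `3`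
  have hord3 : ∀ v ∈ placesOver K 3, ord K v ((((3 : ℕ) : K) ^ 10)⁻¹) = -(10 * (ramIdx K v : ℤ)) := by
    intro v hv
    rw [ord_inv, ord_pow, Cor22.ord_natCast_eq_ramIdx 3 v hv]
    push_cast
    ring
  let X : PilotData K :=
    { jE := ((((3 : ℕ) : K) ^ 10)⁻¹)
      S := placesOver K 3
      S_nonempty := placesOver_nonempty K 3
      ord_jE_neg := fun v hv => by
        rw [hord3 v hv]
        have hpos : 0 < (ramIdx K v : ℤ) := by exact_mod_cast Nat.pos_of_ne_zero (ramIdx_ne_zero K v)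
        linarith
      l := 5
      l_prime := by norm_num
      five_le_l := le_rfl }
  have hlstar : (thetaIndex X).lstar = 2 := by
    show (5 - 1) / 2 = 2
    norm_num
  -- the place over `5`
  obtain ⟨v₀, hv₀mem⟩ := placesOver_nonempty K 5
  have hres₀ : residueChar K v₀ = 5 := (mem_placesOver_iff_residueChar v₀).mp hv₀mem
  have hvp₀ : ((5 : ℕ) : 𝓞 K) ∈ v₀.asIdeal := by
    have h := natCast_residueChar_mem K v₀
    rwa [hres₀] at h
  have hv₀ : (thetaIndex X).over (.inr v₀) = .inr ⟨5, h5.out⟩ := by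
    show (Sum.inr ⟨residueChar K v₀, residueChar_prime K v₀⟩ : Thm311.Real.RatPlace) = Sum.inr ⟨5, h5.out⟩
    congr 1
    exact Subtype.ext hres₀
  -- `5` is totally ramified in `ℚ(ζ₅)`: one place, `e = 4`
  have hspan : ∀ w ∈ placesOver K 5, w.asIdeal = Ideal.span {(IsCyclotomicExtension.zeta_spec 5 ℚ K).toInteger - 1} := by
    intro w hw
    haveI : w.asIdeal.LiesOver (Ideal.span {((5 : ℕ) : ℤ)}) := (mem_placesOver_iff w).mp hw
    exact IsCyclotomicExtension.Rat.eq_span_zeta_sub_one_of_liesOver' (p := 5) K (IsCyclotomicExtension.zeta_spec 5 ℚ K)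
      w.asIdeal
  have huniq : ∀ w ∈ placesOver K 5, w = v₀ := fun w hw =>
    HeightOneSpectrum.ext ((hspan w hw).trans (hspan v₀ hv₀mem).symm)
  have he₀ : absRamificationIdx 5 (RescaledCompletion K 5 v₀ hvp₀) = 4 := by
    haveI : v₀.asIdeal.LiesOver (Ideal.span {((5 : ℕ) : ℤ)}) := (mem_placesOver_iff v₀).mp hv₀mem
    rw [absRamificationIdx_rescaledCompletion K 5 v₀ hvp₀,
      IsCyclotomicExtension.Rat.ramificationIdx_eq_of_prime (p := 5) K v₀.asIdeal]
  refine ⟨X, {⟨3, Nat.prime_three⟩}, fun _ => 1, ⟨5, h5.out⟩, v₀, hv₀, hvp₀, ?_, ?_, ?_, ?_, ?_, ?_, huniq, ?_⟩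
  · -- bad places lie over `3`
    intro pp x hx
    haveI : Fact (pp : ℕ).Prime := ⟨pp.2⟩
    have hres : residueChar K (placeOf X pp.1 x) = pp := (mem_placesOver_iff_residueChar _).mp (placeOf_mem X pp.1 x)
    have hx' : placeOf X pp.1 x ∈ placesOver K 3 := hx
    have h3' : residueChar K (placeOf X pp.1 x) = 3 := (mem_placesOver_iff_residueChar _).mp hx'
    have : pp = ⟨3, Nat.prime_three⟩ := Subtype.ext (hres.symm.trans h3')
    simp [this]
  · -- every place over `3` is bad
    intro pp hpp x
    haveI : Fact (pp : ℕ).Prime := ⟨pp.2⟩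
    rw [Finset.mem_singleton] at hpp
    subst hpp
    exact placeOf_mem X 3 x
  · intro pp hpp
    rw [Finset.mem_singleton] at hpp; subst hpp; norm_num
  · intro pp hpp
    rw [Finset.mem_singleton] at hpp; subst hpp
    rw [IsCyclotomicExtension.Rat.discr_prime (p := 5) K]
    norm_num
  · -- `ord_v(q_v) = 10·e_v = 2·l·e_v·1`
    intro pp hpp x
    haveI : Fact (pp : ℕ).Prime := ⟨pp.2⟩
    rw [Finset.mem_singleton] at hpp
    subst hpp
    have hx : placeOf X 3 x ∈ placesOver K 3 := placeOf_mem X 3 x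
    show ((-ord K (placeOf X 3 x) ((((3 : ℕ) : K) ^ 10)⁻¹) : ℤ) : ℝ) = 2 * ((5 : ℕ) : ℝ) * ramIdx K (placeOf X 3 x) * ((1 : ℕ) : ℝ)
    rw [hord3 _ hx]
    push_cast
    ring
  · show 2 ≤ absRamificationIdx 5 (RescaledCompletion K 5 v₀ hvp₀)
    rw [he₀]; norm_num
  · show ((((thetaIndex X).lstar : ℝ) + 1) * (2 * (thetaIndex X).lstar + 1) / 6 - 1) *
        ∑ pp ∈ ({⟨3, Nat.prime_three⟩} : Finset Nat.Primes), ((1 : ℕ) : ℝ) * Real.log (pp : ℕ) ≤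
      (((absRamificationIdx 5 (RescaledCompletion K 5 v₀ hvp₀) : ℝ) - 1) /
          (absRamificationIdx 5 (RescaledCompletion K 5 v₀ hvp₀) : ℝ)) * ((((thetaIndex X).lstar : ℝ) + 1) / 2) *
        Real.log ((5 : ℕ) : ℝ)
    rw [he₀, hlstar, Finset.sum_singleton]
    have h := three_halves_log_three_le
    push_cast
    norm_num
    linarith

/-- **THE CONVERSE OF Y-21ℓ IS REFUTED AT GENUINE TAME DATA WITH REALISING IDELES — assembled.** Over `F = ℚ(ζ₅)` there is a pilot
datum (`j_E := 3^{−10}`, `S := V(F)₃`, `l := 5`) and a finite set `s` of rational places (`s = {3}`, the primes under `S`) such that for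
EVERY Thm-3.11 context: pilot ideles REALISING `P_Θ`, `P_q` in print's normalisation EXIST (non-zero, units off `S`), and for ALL such
ideles **OUR typed [IUTchIII] Cor. 3.12 `Statement` HOLDS at abc-iut-c312-7's genuine `Real.settingPrVolSharp`, while [J-III] Cor 9.11.1.1
read through the dictionary FAILS (`¬ A.Cor91111`) for EVERY adelic Θ-values-locus datum `A` on `s` reading the genuine `q`-volumes and
hull volumes — and such a reading datum exists.** (Parts III §2–§3 at the datum of `exists_pilotData_cyclotomicField_five_realising_hypotheses`.)
No side taken: the Statement holds here BY (Ind1)/(Ind2)-INFLATION of the unit boxes at the `5`-packets (quantitative ramified hull gain,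
parts I–II), «saying nothing about print's intended content»; `ℚ(ζ₅) ∌ √−1` is a bed, not the field of moduli of an initial Θ-datum.
[claim: Joshi2024ATS3, status: disputed] [claim: Mochizuki2012, status: disputed] [cite: DupuyHilado2025, §3.3, §3.4, §3.6, §3.9, §4.7, §4.9] -/
theorem exists_realising_statement_and_not_cor91111_cyclotomicField_five :
    ∃ (X : PilotData (CyclotomicField 5 ℚ)) (s : Finset (thetaIndex X).VQ),
      ∀ {logv : PadicLogs (CyclotomicField 5 ℚ)} (hlog : LogvAnalytic logv) (M : Type) [Field M] [NumberField M]
        (archPk : ∀ (j : (thetaIndex X).Label) (vQ : (thetaIndex X).VQ), Set ((logShellsDH X logv).Packet j vQ))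
        (archSub : ∀ (j : (thetaIndex X).Label) (v : (thetaIndex X).V),
          Set ((logShellsDH X logv).Packet j ((thetaIndex X).over v)))
        (Ψ : ℤ → ∀ v : (thetaIndex X).V, v ∈ (thetaIndex X).Vbad → Set ((logShellsDH X logv).StarPacket v))
        (act : ℤ → ∀ v : (thetaIndex X).V, v ∈ (thetaIndex X).Vbad →
          (logShellsDH X logv).StarPacket v → Module.End ℚ ((logShellsDH X logv).StarPacket v))
        (Mmod : ℤ → ∀ j : (thetaIndex X).LabelStar, Set ((logShellsDH X logv).GlobalPacket j.1))
        (region : ℤ → ∀ j : (thetaIndex X).LabelStar, FinDivisor M → ∀ vQ : (thetaIndex X).VQ,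
          Set ((logShellsDH X logv).Packet j.1 vQ))
        (n : ℤ) {HT : Type} {LogLink : HT → HT → Type} {IsFull : ∀ {s t : HT}, LogLink s t → Prop}
        (lat : LGPGaussianLogThetaLattice LogLink IsFull)
        {Frd : Type} {IsoF : Frd → Frd → Type} {Ob : Frd → Type} {realify : Frd → Frd} {Strip : Type}
        {IsoS : Strip → Strip → Type} {Mv : ∀ v : (thetaIndex X).V, v ∈ (thetaIndex X).Vbad → Type}
        [∀ v h, Monoid (Mv v h)]
        (sig : GlobalLGPFrobenioidSignature (thetaIndex X).lstar (thetaIndex X).V (· ∈ (thetaIndex X).Vbad)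
          Frd IsoF Ob realify Strip IsoS Mv)
        (split : SplittingMonoids Mv) {ObΔ : Type} {N : ∀ v : (thetaIndex X).V, v ∈ (thetaIndex X).Vbad → Type}
        [∀ v h, Monoid (N v h)] (qData : QPilotData ObΔ N),
      (∃ (tq : ∀ (pp : Nat.Primes) (x : (thetaIndex X).Fibre (.inr pp)), haveI : Fact (pp : ℕ).Prime := ⟨pp.2⟩; kOf X pp.1 x)
          (t : ∀ (pp : Nat.Primes) (_ : Fin X.lstar) (x : (thetaIndex X).Fibre (.inr pp)),
            haveI : Fact (pp : ℕ).Prime := ⟨pp.2⟩; kOf X pp.1 x),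
          (∀ pp x, tq pp x ≠ 0) ∧
          (∀ (pp : Nat.Primes) (x : (thetaIndex X).Fibre (.inr pp)),
            haveI : Fact (pp : ℕ).Prime := ⟨pp.2⟩; placeOf X pp.1 x ∉ X.S → ‖tq pp x‖ = 1) ∧
          (∀ pp i x, t pp i x ≠ 0) ∧
          (∀ (pp : Nat.Primes) (i : Fin X.lstar) (x : (thetaIndex X).Fibre (.inr pp)),
            haveI : Fact (pp : ℕ).Prime := ⟨pp.2⟩; placeOf X pp.1 x ∉ X.S → ‖t pp i x‖ = 1) ∧
          (∀ (pp : Nat.Primes) (i : Fin X.lstar) (x : (thetaIndex X).Fibre (.inr pp)),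
            haveI : Fact (pp : ℕ).Prime := ⟨pp.2⟩;
            Real.log ‖t pp i x‖ = -(X.thetaPilot i (placeOf X pp.1 x)) * logNorm (CyclotomicField 5 ℚ) (placeOf X pp.1 x) /
              localDegree (CyclotomicField 5 ℚ) (placeOf X pp.1 x)) ∧
          (∀ (pp : Nat.Primes) (x : (thetaIndex X).Fibre (.inr pp)),
            haveI : Fact (pp : ℕ).Prime := ⟨pp.2⟩;
            Real.log ‖tq pp x‖ = -(X.qPilot (placeOf X pp.1 x)) * logNorm (CyclotomicField 5 ℚ) (placeOf X pp.1 x) /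
              localDegree (CyclotomicField 5 ℚ) (placeOf X pp.1 x))) ∧
      ∀ (tq : ∀ (pp : Nat.Primes) (x : (thetaIndex X).Fibre (.inr pp)), haveI : Fact (pp : ℕ).Prime := ⟨pp.2⟩; kOf X pp.1 x)
        (t : ∀ (pp : Nat.Primes) (_ : Fin X.lstar) (x : (thetaIndex X).Fibre (.inr pp)),
          haveI : Fact (pp : ℕ).Prime := ⟨pp.2⟩; kOf X pp.1 x)
        (htq0 : ∀ pp x, tq pp x ≠ 0)
        (htq1 : ∀ (pp : Nat.Primes) (x : (thetaIndex X).Fibre (.inr pp)),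
          haveI : Fact (pp : ℕ).Prime := ⟨pp.2⟩; placeOf X pp.1 x ∉ X.S → ‖tq pp x‖ = 1)
        (_ : ∀ pp i x, t pp i x ≠ 0)
        (_ : ∀ (pp : Nat.Primes) (i : Fin X.lstar) (x : (thetaIndex X).Fibre (.inr pp)),
          haveI : Fact (pp : ℕ).Prime := ⟨pp.2⟩; placeOf X pp.1 x ∉ X.S → ‖t pp i x‖ = 1)
        (_ : ∀ (pp : Nat.Primes) (i : Fin X.lstar) (x : (thetaIndex X).Fibre (.inr pp)),
          haveI : Fact (pp : ℕ).Prime := ⟨pp.2⟩;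
          Real.log ‖t pp i x‖ = -(X.thetaPilot i (placeOf X pp.1 x)) * logNorm (CyclotomicField 5 ℚ) (placeOf X pp.1 x) /
            localDegree (CyclotomicField 5 ℚ) (placeOf X pp.1 x))
        (_ : ∀ (pp : Nat.Primes) (x : (thetaIndex X).Fibre (.inr pp)),
          haveI : Fact (pp : ℕ).Prime := ⟨pp.2⟩;
          Real.log ‖tq pp x‖ = -(X.qPilot (placeOf X pp.1 x)) * logNorm (CyclotomicField 5 ℚ) (placeOf X pp.1 x) /
            localDegree (CyclotomicField 5 ℚ) (placeOf X pp.1 x)),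
        (settingPrVolSharp X hlog M archPk archSub Ψ act Mmod region n lat sig split qData tq t htq0 htq1).Statement ∧
          (∀ A : ATS3.AdelicLocusDatum (thetaIndex X).lstar s,
            (∀ (i : Fin (thetaIndex X).lstar) (w : s), Real.log (A.loc w).qroot =
              (settingPrVolSharp X hlog M archPk archSub Ψ act Mmod region n lat sig split qData tq t htq0 htq1).qLocal
                (Setting.labelSucc i) w) →
            (∀ w : s, Real.log (A.loc w).hullVol =
              ∑ i : Fin (thetaIndex X).lstar, ((situationPrVol X hlog M archPk archSub Ψ act Mmod region).D n).logvol
                (Setting.labelSucc i) w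
                ((settingPrVolSharp X hlog M archPk archSub Ψ act Mmod region n lat sig split qData tq t htq0 htq1).thetaHull
                  (Setting.labelSucc i) w)) →
            ¬ A.Cor91111) ∧
          ∃ A : ATS3.AdelicLocusDatum (thetaIndex X).lstar s,
            (∀ (i : Fin (thetaIndex X).lstar) (w : s), Real.log (A.loc w).qroot =
              (settingPrVolSharp X hlog M archPk archSub Ψ act Mmod region n lat sig split qData tq t htq0 htq1).qLocal
                (Setting.labelSucc i) w) ∧
            (∀ w : s, Real.log (A.loc w).hullVol =
              ∑ i : Fin (thetaIndex X).lstar, ((situationPrVol X hlog M archPk archSub Ψ act Mmod region).D n).logvol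
                (Setting.labelSucc i) w
                ((settingPrVolSharp X hlog M archPk archSub Ψ act Mmod region n lat sig split qData tq t htq0 htq1).thetaHull
                  (Setting.labelSucc i) w)) := by
  classical
  obtain ⟨X, U, mq, p₀, v₀, hv₀, hvp₀, hU, hUS, hU2, hUd, hord, he₀, huniq₀, hnum⟩ :=
    exists_pilotData_cyclotomicField_five_realising_hypotheses
  set sU : Finset (thetaIndex X).VQ :=
    U.map ⟨fun pp => (Sum.inr pp : (thetaIndex X).VQ), fun _ _ h => Sum.inr_injective h⟩ with hsU
  have hs : ∀ w : (thetaIndex X).VQ, w ∈ sU ↔ ∃ pp ∈ U, w = Sum.inr pp := fun w => by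
    rw [hsU, Finset.mem_map]
    exact ⟨fun ⟨pp, hpp, h⟩ => ⟨pp, hpp, h.symm⟩, fun ⟨pp, hpp, h⟩ => ⟨pp, hpp, h.symm⟩⟩
  refine ⟨X, sU, ?_⟩
  intro logv hlog M _ _ archPk archSub Ψ act Mmod region n HT LogLink IsFull lat Frd IsoF Ob realify Strip IsoS Mv _ sig split ObΔ N _
    qData
  refine ⟨?_, fun tq t htq0 htq1 ht0 ht1 ht htq => ?_⟩
  · obtain ⟨tq, t, htq0, htq1, ht0, ht1, ht, htq⟩ := exists_realising_ideles X U hU hUS mq hord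
    exact ⟨tq, t, htq0, htq1, ht0, ht1, ht, htq⟩
  · exact statement_and_not_cor91111_of_realising X hlog M archPk archSub Ψ act Mmod region n lat sig split qData U hU hUS hU2 hUd mq
      hord t tq ht0 ht1 htq0 htq1 ht htq p₀ v₀ hv₀ hvp₀ he₀ huniq₀ hnum sU hs

end TestATS4LowerBound

end Summit.ABC.IUTFork.Joshi

end
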